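import Summits.BirchSwinnertonDyer.BirchSwinnertonDyer.Theorems.ThetaPartnerAtTwoSignedKatoUpToAtTwoLocalTwoPlusPointsExact
import HarnessLib

/-!
# Route `ThetaPartnerAtTwo` (TP2), crux K3 `SignedKatoDivisibilityUpToAtTwo` (item stmt-BirchSwinnertonDyer-20308),
# line `colemanrat` v3 — THE LOCAL THEORY AT `p = 2`, file 12: the `ℤ₂`-TOWER POINTS `d_n = 3·e_n − 2·c_1` with EXACT trace
# relations `Tr_{n/n−1} d_n = −d_{n−2}`, fixed by `⟨Stab ζ_{2^{n+2}}, σ⟩`, and `d_0 ∉ 2·E(ℚ₂)` (the point half of HONDA⁺@2)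

HONEST FRAMING (cell `bsd-wall`, lead `bsd-wall-tp2-p2x` g3): THEOREMS ONLY — no definition, no named fact, no
instance, no `sorry`; local formal-group theory over `ℚ₂(μ_{2^∞})`; nothing about any Selmer group is asserted;
closes no item; BSD is NOT proved by any of this.

## Why this file

Residue (b) of the port memo `Cruxes/SignedKatoDivisibilityUpToAtTwo/G2-PORT-AT-2.md` §8 and clauses (L)(TR)(GEN₀) of K4's
registered stub `stub_plusHondaSystemTwo` (crux `SignedControlAtTwo`, line `eulerchar` v6; split agreed on the cell bus
2026-08-27T23:27:44Z, (2)(a)). With the EXACT `Δ`-twisted trace relation of file 11 (`Tr_{n/n−1} e_n + e_{n−2} = 2c_1`,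
`e_n = c_{n+2} + σ_{n+2} c_{n+2}`), the integral renormalisation (NO division, NO exponential)
  **`d_n := 3·e_n − 2·c_1`**, `Λ(d_n) = 3(ℓ_{n+2} + σ_{n+2}ℓ_{n+2}) + 4`,
satisfies `Tr_{n/n−1} d_n = 3(−e_{n−2} + 2c_1) − 4c_1 = −d_{n−2}` on the nose, is fixed by `Stab ζ_{2^{n+2}}` and by every
inverter of `ζ_{2^{n+2}}` (i.e. `d_n ∈ E(ℚ_{2,n})`, `ℚ_{2,n} = ℚ₂(ζ_{2^{n+2}})⁺`), and `Λ(d_0) = 3·(−2) + 4 = −2` has `‖·‖ = ‖2‖`, whence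
`d_0 ∉ 2·E(ℚ₂)`: for a `Γ`-fixed `b`, `3b ∈ Ê(2ℤ₂)` (`#Ẽ(𝔽₂) = 3`), `‖Λ(3b)‖ ≤ ‖2‖`, so `‖Λ(2·3b)‖ ≤ ‖4‖ < ‖2‖ = ‖Λ(3d_0)‖`.
Multiplying `e_n` by the unit `3 ∈ ℤ₂ˣ` is invisible modulo `2` (`e_n ∈ ℤ·d_n + 2·E`), so generation statements are unaffected.
The dictionary to `localLayerPointsOfEmb κ ι W n` / `localTraceOfEmb` for the CYCLOTOMIC `κ` (layer-`n` subgroup =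
`⟨Stab ζ_{2^{n+2}}, σ⟩`, trace = the coset sum below) is the K4 width seat's `…SignedControlAtTwoPlusLayerTwo`; not repeated here.

## What is proved (`M/ℤ₂` with elliptic fibres, `2 ∣ a₁`, `tr(M ⊗ 𝔽₂) = 0`, `M ⊗ ℚ̄₂ = W ⊗ ℚ̄₂`; `Γ = Gal(ℚ̄₂/ℚ₂)` on `localPoints W ℚ_[2]`)

* `norm_ptLogΩ_le_half_of_mem_layer_zero` (`‖Λ(Q)‖ ≤ ‖2‖` on `Ê(2ℤ₂)`), `smul_toLoc_eq_of_mem_stab`, `smul_toLoc_one_eq`;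
* `plusPoints_symm_mem` (`d_n ∈ L(n+2) ∩ E₁`, `Λ(d_n)`), `plusPoints_smul_eq_of_mem_stab`, `plusPoints_smul_eq_of_inverter` (L),
  `plusPoints_trace` (TR: `∑_{q ∈ Stab ζ_{2^{n+3}}/Stab ζ_{2^{n+4}}} q̃ • d_{n+2} = −d_n`), `plusPoints_zero_ne_two_nsmul` (GEN₀, valuation form);
* `exists_plusPoints_two` (packaged, with the tower points and inverters displayed) and `exists_plusPoints_two_of_goodSS` for
  `W/ℚ` globally minimal with `GoodSS W 2`, `a₂(W) = 0` on the model `M_W` of file 6 — no hypothesis beyond K3's/K4's binders.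

References: [Kobayashi2003] §8.4, Lemma 8.9, Prop. 8.12; [KuriharaOtsuki2006] §1.3, Prop. 1.4, p. 557; [Sprung2012] Thm. 2.2 (2′)
(p. 1487); [SilvermanAEC2009] IV.6.4, VII.2 Prop. 2.1; [MilneADT2006] I Lemma 3.3.
-/

set_option autoImplicit false
-- the Theorems namespace of this sub repeats the summit name by design (D-0017 nested layout)
set_option linter.dupNamespace false

noncomputable section

open scoped Classical Topology NNReal
open Filter PowerSeries Finset

namespace Summit.BirchSwinnertonDyer.BirchSwinnertonDyer.Theorems

namespace SignedKatoOffTwo.LocalTwo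

open Literature.RingTheory.FormalGroups WeierstrassCurve Field
open Summit.BirchSwinnertonDyer.Rank1Residual.Additive
open Summit.BirchSwinnertonDyer.Rank1Residual.Additive.PadicCyclotomicTower
open Summit.BirchSwinnertonDyer.Rank1Residual.Additive.BallEval
open Summit.BirchSwinnertonDyer.BirchSwinnertonDyer.Theorems.SignedKatoOffTwo.LocalAllPrimes
open Literature.NumberTheory.EllipticCurves Literature.NumberTheory.EllipticCurves.FormalGroupChart
open Literature.NumberTheory.GaloisRepresentations
open Literature.NumberTheory.EllipticCurves.Rank1Residual

/-! ## §5 The `ℤ₂`-tower points `d_n = 3·e_n − 2·c_1` in `localPoints W ℚ_[2]` -/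

section Loc

variable {K : Type} [Field K] [Algebra K ℚ_[2]] {W : WeierstrassCurve K} {M : WeierstrassCurve ℤ_[2]}
  [hE : (M.map PadicInt.Coe.ringHom).IsElliptic] [hEt : (M.map PadicInt.toZMod).IsElliptic]

variable (hV : genFibΩ 2 M = W.baseChange (AlgebraicClosure ℚ_[2]))

omit hEt in
/-- **The `ℤ₂`-tower points, read on `E_Ω`**: for tower points `c_m ∈ L(m) ∩ E₁`, `Λ(c_m) = ℓ_m` (files 2/6) and
inverters `σ_m` of `ζ_{2^m}`, the point `d_n := 3 • (c_{n+2} + σ_{n+2} • c_{n+2}) − 2 • c_1` (transported along `toLoc`)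
has coordinates in `ℚ₂(ζ_{2^{n+2}})`, lies in `E₁`, and has logarithm `Λ(d_n) = 3(ℓ_{n+2} + σ_{n+2}•ℓ_{n+2}) + 4`.
[cite: Kobayashi2003, §8.4] [cite: KuriharaOtsuki2006, §1.3] -/
theorem plusPoints_symm_mem [hintΩ : (genFibΩ 2 M).IsIntegral (Valued.v (R := PadicAlgCl 2)).integer]
    {c : ℕ → (genFibΩ 2 M).toAffine.Point}
    (hc : ∀ m, c m ∈ subfieldPoints (genFibΩ 2 M) (layer 2 m).toSubfield coeffs_mem_layer ∧
      c m ∈ kernel (Valued.v (R := PadicAlgCl 2)) (genFibΩ 2 M) ∧ ptLogΩ 2 M (c m) = ell 2 m)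
    (σ : ℕ → Field.absoluteGaloisGroup ℚ_[2]) (n : ℕ) :
    (toLoc hV).symm (3 • (toLoc hV (c (n + 2)) + σ (n + 2) • toLoc hV (c (n + 2))) - 2 • toLoc hV (c 1)) ∈
        subfieldPoints (genFibΩ 2 M) (layer 2 (n + 2)).toSubfield coeffs_mem_layer ∧
      (toLoc hV).symm (3 • (toLoc hV (c (n + 2)) + σ (n + 2) • toLoc hV (c (n + 2))) - 2 • toLoc hV (c 1)) ∈
        kernel (Valued.v (R := PadicAlgCl 2)) (genFibΩ 2 M) ∧
      ptLogΩ 2 M ((toLoc hV).symm (3 • (toLoc hV (c (n + 2)) + σ (n + 2) • toLoc hV (c (n + 2))) - 2 • toLoc hV (c 1))) =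
        3 * (ell 2 (n + 2) + σ (n + 2) • ell 2 (n + 2)) + 4 := by
  haveI := isIntegral_curveK 2 (LayerField 2 (n + 2)) M
  set e := toLoc hV with he
  set act : Field.absoluteGaloisGroup ℚ_[2] → (genFibΩ 2 M).toAffine.Point → (genFibΩ 2 M).toAffine.Point :=
    fun τ Q => e.symm (τ • e Q) with hact_def
  have hact0 : ∀ τ, act τ 0 = 0 := fun τ => act_zero hV τ
  have hact : ∀ τ (x y : PadicAlgCl 2) (h : (genFibΩ 2 M).toAffine.Nonsingular x y),
      ∃ h', act τ (Affine.Point.some x y h) = Affine.Point.some (τ • x) (τ • y) h' := fun τ x y h => act_some hV τ x y h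
  have hrew : e.symm (3 • (e (c (n + 2)) + σ (n + 2) • e (c (n + 2))) - 2 • e (c 1)) =
      3 • (c (n + 2) + act (σ (n + 2)) (c (n + 2))) - 2 • c 1 := by
    simp only [hact_def, map_sub, map_nsmul, map_add, AddEquiv.symm_apply_apply]
  have hσcL : act (σ (n + 2)) (c (n + 2)) ∈ subfieldPoints (genFibΩ 2 M) (layer 2 (n + 2)).toSubfield coeffs_mem_layer :=
    act_mem_subfieldPoints act hact0 hact _ (hc (n + 2)).1
  have hσck : act (σ (n + 2)) (c (n + 2)) ∈ kernel (Valued.v (R := PadicAlgCl 2)) (genFibΩ 2 M) :=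
    act_mem_kernel act hact0 hact _ (hc (n + 2)).2.1
  have hc1L : c 1 ∈ subfieldPoints (genFibΩ 2 M) (layer 2 (n + 2)).toSubfield coeffs_mem_layer :=
    subfieldPoints_layer_mono (by omega) (hc 1).1
  have heL : c (n + 2) + act (σ (n + 2)) (c (n + 2)) ∈ subfieldPoints (genFibΩ 2 M) (layer 2 (n + 2)).toSubfield coeffs_mem_layer :=
    (subfieldPoints _ _ _).add_mem (hc (n + 2)).1 hσcL
  have hek : c (n + 2) + act (σ (n + 2)) (c (n + 2)) ∈ kernel (Valued.v (R := PadicAlgCl 2)) (genFibΩ 2 M) :=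
    (kernel (Valued.v (R := PadicAlgCl 2)) (genFibΩ 2 M)).add_mem (hc (n + 2)).2.1 hσck
  rw [hrew]
  refine ⟨(subfieldPoints _ _ _).sub_mem ((subfieldPoints _ _ _).nsmul_mem heL 3) ((subfieldPoints _ _ _).nsmul_mem hc1L 2),
    (kernel (Valued.v (R := PadicAlgCl 2)) (genFibΩ 2 M)).sub_mem
      ((kernel (Valued.v (R := PadicAlgCl 2)) (genFibΩ 2 M)).nsmul_mem hek 3)
      ((kernel (Valued.v (R := PadicAlgCl 2)) (genFibΩ 2 M)).nsmul_mem (hc 1).2.1 2), ?_⟩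
  rw [ptLogΩ_sub (m := n + 2) ((subfieldPoints _ _ _).nsmul_mem heL 3) ((subfieldPoints _ _ _).nsmul_mem hc1L 2)
      ((kernel (Valued.v (R := PadicAlgCl 2)) (genFibΩ 2 M)).nsmul_mem hek 3)
      ((kernel (Valued.v (R := PadicAlgCl 2)) (genFibΩ 2 M)).nsmul_mem (hc 1).2.1 2),
    ptLogΩ_nsmul (m := n + 2) heL hek 3, ptLogΩ_nsmul (m := n + 2) hc1L (hc 1).2.1 2,
    ptLogΩ_add (m := n + 2) (hc (n + 2)).1 hσcL (hc (n + 2)).2.1 hσck,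
    ptLogΩ_act act hact0 hact _ (norm_zCoord_lt_one_of_mem_kernel (hc (n + 2)).2.1), (hc (n + 2)).2.2, (hc 1).2.2,
    ell_two_one]
  push_cast
  ring

omit hE hEt in
/-- **`‖Λ(Q)‖ ≤ ‖2‖` for `Q ∈ Ê(2ℤ₂)`** (a point of `E₁` with coordinates in `ℚ₂`): `z(Q) ∈ 2ℤ₂` and
`‖log z − z‖ ≤ 2‖z‖² ≤ 1/2`. [cite: SilvermanAEC2009, IV.6.4] -/
theorem norm_ptLogΩ_le_half_of_mem_layer_zero [hintΩ : (genFibΩ 2 M).IsIntegral (Valued.v (R := PadicAlgCl 2)).integer]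
    {Q : (genFibΩ 2 M).toAffine.Point}
    (hQ : Q ∈ subfieldPoints (genFibΩ 2 M) (layer 2 0).toSubfield coeffs_mem_layer)
    (hk : Q ∈ kernel (Valued.v (R := PadicAlgCl 2)) (genFibΩ 2 M)) : ‖ptLogΩ 2 M Q‖ ≤ 1 / 2 := by
  haveI := isIntegral_curveK 2 (LayerField 2 0) M
  obtain ⟨P, rfl⟩ := exists_toOmega_eq hQ
  have hP : P ∈ kernel (NormedField.valuation (K := LayerField 2 0)) (curveK 2 (LayerField 2 0) M) :=
    (toOmega_mem_kernel_iff P).mp hk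
  rw [ptLogΩ_toOmega hP, LayerField.norm_emb]
  -- `‖z(P)‖ ≤ 1/2`: a `ℚ₂`-rational element of norm `< 1`
  have hz1 : ‖P.zCoord‖ < 1 := norm_zCoord_lt_one hP
  have hzmem : LayerField.emb 2 0 P.zCoord ∈ (⊥ : IntermediateField ℚ_[2] (PadicAlgCl 2)) := by
    rw [← layer_zero]; exact LayerField.emb_mem _
  obtain ⟨c, hc⟩ := IntermediateField.mem_bot.mp hzmem
  have hzc : ‖P.zCoord‖ = ‖c‖ := by rw [← LayerField.norm_emb, ← hc, norm_algebraMap']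
  have hz : ‖P.zCoord‖ ≤ 1 / 2 := by
    rw [hzc] at hz1 ⊢
    have h := (Padic.norm_lt_pow_iff_norm_le_pow_sub_one c 0).mp (by simpa using hz1)
    simpa using h
  -- `‖log z‖ ≤ max ‖log z − z‖ ‖z‖ ≤ 1/2`
  have hsub := norm_bLog_sub_le_two (p := 2) (M := M) hz
  have hsub' : ‖bLog 2 (LayerField 2 0) M P.zCoord - P.zCoord‖ ≤ 1 / 2 := by
    refine hsub.trans ?_
    nlinarith [norm_nonneg P.zCoord, hz]
  calc ‖ptLog 2 (LayerField 2 0) M P‖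
      = ‖(bLog 2 (LayerField 2 0) M P.zCoord - P.zCoord) + P.zCoord‖ := by rw [ptLog, sub_add_cancel]
    _ ≤ max ‖bLog 2 (LayerField 2 0) M P.zCoord - P.zCoord‖ ‖P.zCoord‖ := IsUltrametricDist.norm_add_le_max _ _
    _ ≤ 1 / 2 := max_le hsub' hz

omit hEt in
/-- **(L) part 1: `d_n` is fixed by `Stab ζ_{2^{n+2}}`** (coordinates in `ℚ₂(ζ_{2^{n+2}})`). [cite: Kobayashi2003, §8.4] -/
theorem plusPoints_smul_eq_of_mem_stab
    {c : ℕ → (genFibΩ 2 M).toAffine.Point}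
    (hc : haveI := isIntegral_genFib_baseChange 2 M
      ∀ m, c m ∈ subfieldPoints (genFibΩ 2 M) (layer 2 m).toSubfield coeffs_mem_layer ∧
      c m ∈ kernel (Valued.v (R := PadicAlgCl 2)) (genFibΩ 2 M) ∧ ptLogΩ 2 M (c m) = ell 2 m)
    (σ : ℕ → Field.absoluteGaloisGroup ℚ_[2]) (n : ℕ) {τ : Field.absoluteGaloisGroup ℚ_[2]} (hτ : τ ∈ stab 2 (n + 2)) :
    τ • (3 • (toLoc hV (c (n + 2)) + σ (n + 2) • toLoc hV (c (n + 2))) - 2 • toLoc hV (c 1)) =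
      3 • (toLoc hV (c (n + 2)) + σ (n + 2) • toLoc hV (c (n + 2))) - 2 • toLoc hV (c 1) := by
  haveI := isIntegral_genFib_baseChange 2 M
  exact (forall_smul_eq_iff_mem_subfieldPoints hV (n + 2) _).mpr (plusPoints_symm_mem hV hc σ n).1 τ hτ

omit hE hEt in
/-- A tower point `c_m` (coordinates in `ℚ₂(ζ_{2^m})`) is fixed by `Stab ζ_{2^m}`. [folklore] -/
theorem smul_toLoc_eq_of_mem_stab [hintΩ : (genFibΩ 2 M).IsIntegral (Valued.v (R := PadicAlgCl 2)).integer]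
    {c : ℕ → (genFibΩ 2 M).toAffine.Point}
    (hc : ∀ m, c m ∈ subfieldPoints (genFibΩ 2 M) (layer 2 m).toSubfield coeffs_mem_layer ∧
      c m ∈ kernel (Valued.v (R := PadicAlgCl 2)) (genFibΩ 2 M) ∧ ptLogΩ 2 M (c m) = ell 2 m)
    (m : ℕ) {τ : Field.absoluteGaloisGroup ℚ_[2]} (hτ : τ ∈ stab 2 m) : τ • toLoc hV (c m) = toLoc hV (c m) := by
  refine (forall_smul_eq_iff_mem_subfieldPoints hV m _).mpr ?_ τ hτ
  rw [AddEquiv.symm_apply_apply]; exact (hc m).1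

omit hE hEt in
/-- The bottom tower point `c_1 ∈ E(ℚ₂)` is fixed by all of `Γ`. [folklore] -/
theorem smul_toLoc_one_eq [hintΩ : (genFibΩ 2 M).IsIntegral (Valued.v (R := PadicAlgCl 2)).integer]
    {c : ℕ → (genFibΩ 2 M).toAffine.Point}
    (hc : ∀ m, c m ∈ subfieldPoints (genFibΩ 2 M) (layer 2 m).toSubfield coeffs_mem_layer ∧
      c m ∈ kernel (Valued.v (R := PadicAlgCl 2)) (genFibΩ 2 M) ∧ ptLogΩ 2 M (c m) = ell 2 m)
    (τ : Field.absoluteGaloisGroup ℚ_[2]) : τ • toLoc hV (c 1) = toLoc hV (c 1) :=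
  smul_toLoc_eq_of_mem_stab hV hc 1 (by rw [stab_two_one]; exact Subgroup.mem_top τ)

omit hE hEt in
/-- **(L) part 2: `d_n` is fixed by EVERY inverter of `ζ_{2^{n+2}}`** (so `d_n ∈ E(ℚ_{2,n})`, the fixed field of
`⟨Stab ζ_{2^{n+2}}, σ⟩ = Gal(ℚ̄₂/ℚ₂(ζ_{2^{n+2}})⁺)`). [cite: Kobayashi2003, §8.4] [cite: KuriharaOtsuki2006, §1.3] -/
theorem plusPoints_smul_eq_of_inverter
    {c : ℕ → (genFibΩ 2 M).toAffine.Point}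
    (hc : haveI := isIntegral_genFib_baseChange 2 M
      ∀ m, c m ∈ subfieldPoints (genFibΩ 2 M) (layer 2 m).toSubfield coeffs_mem_layer ∧
      c m ∈ kernel (Valued.v (R := PadicAlgCl 2)) (genFibΩ 2 M) ∧ ptLogΩ 2 M (c m) = ell 2 m)
    {σ : ℕ → Field.absoluteGaloisGroup ℚ_[2]} (n : ℕ) (hσ : σ (n + 2) • zeta 2 (n + 2) = (zeta 2 (n + 2))⁻¹)
    {σ' : Field.absoluteGaloisGroup ℚ_[2]} (hσ' : σ' • zeta 2 (n + 2) = (zeta 2 (n + 2))⁻¹) :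
    σ' • (3 • (toLoc hV (c (n + 2)) + σ (n + 2) • toLoc hV (c (n + 2))) - 2 • toLoc hV (c 1)) =
      3 • (toLoc hV (c (n + 2)) + σ (n + 2) • toLoc hV (c (n + 2))) - 2 • toLoc hV (c 1) := by
  haveI := isIntegral_genFib_baseChange 2 M
  rw [smul_sub, smul_comm σ' 3, smul_comm σ' 2, smul_toLoc_one_eq hV hc σ',
    smul_add_smul_eq_of_smul_zeta_eq_inv hσ hσ' (fun τ hτ => smul_toLoc_eq_of_mem_stab hV hc (n + 2) hτ)]

/-- **(TR): the EXACT trace relation `Tr_{n+2/n+1} d_{n+2} = −d_n`** in `localPoints W ℚ_[2]`: the trace down the quadratic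
step `ℚ_{2,n+2}/ℚ_{2,n+1}` is the sum over `Stab ζ_{2^{n+3}}/Stab ζ_{2^{n+4}}` (any representatives), and
`∑_q q̃ • d_{n+2} = 3·(2c_1 − e_n) − 4c_1 = −d_n` by §2. [cite: Kobayashi2003, Lemma 8.9] [cite: Sprung2012, Thm. 2.2 (2′)]
[cite: KuriharaOtsuki2006, Prop. 1.4] -/
theorem plusPoints_trace (h₁ : M.a₁ ∈ IsLocalRing.maximalIdeal ℤ_[2])
    {c : ℕ → (genFibΩ 2 M).toAffine.Point}
    (hc : haveI := isIntegral_genFib_baseChange 2 M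
      ∀ m, c m ∈ subfieldPoints (genFibΩ 2 M) (layer 2 m).toSubfield coeffs_mem_layer ∧
      c m ∈ kernel (Valued.v (R := PadicAlgCl 2)) (genFibΩ 2 M) ∧ ptLogΩ 2 M (c m) = ell 2 m)
    {σ : ℕ → Field.absoluteGaloisGroup ℚ_[2]} (hσ : ∀ m, 1 ≤ m → σ m • zeta 2 m = (zeta 2 m)⁻¹) (n : ℕ)
    [Fintype (stab 2 (n + 3) ⧸ (stab 2 (n + 3 + 1)).subgroupOf (stab 2 (n + 3)))] :
    ∑ q : stab 2 (n + 3) ⧸ (stab 2 (n + 3 + 1)).subgroupOf (stab 2 (n + 3)),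
        ((q.out : stab 2 (n + 3)) : Field.absoluteGaloisGroup ℚ_[2]) •
          (3 • (toLoc hV (c (n + 4)) + σ (n + 4) • toLoc hV (c (n + 4))) - 2 • toLoc hV (c 1)) =
      -(3 • (toLoc hV (c (n + 2)) + σ (n + 2) • toLoc hV (c (n + 2))) - 2 • toLoc hV (c 1)) := by
  haveI hintΩ := isIntegral_genFib_baseChange 2 M
  set e := toLoc hV with he
  set act : Field.absoluteGaloisGroup ℚ_[2] → (genFibΩ 2 M).toAffine.Point → (genFibΩ 2 M).toAffine.Point :=
    fun τ Q => e.symm (τ • e Q) with hact_def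
  have hact0 : ∀ τ, act τ 0 = 0 := fun τ => act_zero hV τ
  have hact : ∀ τ (x y : PadicAlgCl 2) (h : (genFibΩ 2 M).toAffine.Nonsingular x y),
      ∃ h', act τ (Affine.Point.some x y h) = Affine.Point.some (τ • x) (τ • y) h' := fun τ x y h => act_some hV τ x y h
  have he_act : ∀ τ Q, e (act τ Q) = τ • e Q := fun τ Q => by simp only [hact_def, AddEquiv.apply_symm_apply]
  -- §2 at `m = n + 3`, transported along `e`
  have hrel := sum_act_add_sum_act_add_eq_two_nsmul h₁ act hact0 hact (σ (n + 4)) (m := n + 3) (by omega)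
    (c := c (n + 4)) (c' := c (n + 2)) (c₁ := c 1) (hc (n + 3 + 1)).1 (hc (n + 3 + 1)).2.1 (hc (n + 3 + 1)).2.2
    (by simpa using (hc (n + 2)).1) (hc (n + 2)).2.1 (by simpa using (hc (n + 2)).2.2) (hc 1).1 (hc 1).2.1 (hc 1).2.2
  have hrel' := congrArg e hrel
  simp only [map_add, map_sum, map_nsmul, he_act] at hrel'
  -- `σ_{n+4}` and `σ_{n+2}` agree on `c_{n+2}`
  have hσ42 : σ (n + 4) • e (c (n + 2)) = σ (n + 2) • e (c (n + 2)) :=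
    smul_eq_smul_of_smul_zeta_eq_inv (hσ (n + 2) (by omega))
      (smul_zeta_eq_inv_of_le (by omega : n + 2 ≤ n + 4) (hσ (n + 4) (by omega)))
      (fun τ hτ => smul_toLoc_eq_of_mem_stab hV hc (n + 2) hτ)
  -- the representatives fix `c_1`
  have hq1 : ∀ q : stab 2 (n + 3) ⧸ (stab 2 (n + 3 + 1)).subgroupOf (stab 2 (n + 3)),
      ((q.out : stab 2 (n + 3)) : Field.absoluteGaloisGroup ℚ_[2]) • e (c 1) = e (c 1) := fun q => smul_toLoc_one_eq hV hc _
  have hsum : ∑ q : stab 2 (n + 3) ⧸ (stab 2 (n + 3 + 1)).subgroupOf (stab 2 (n + 3)),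
      ((q.out : stab 2 (n + 3)) : Field.absoluteGaloisGroup ℚ_[2]) •
        (3 • (e (c (n + 4)) + σ (n + 4) • e (c (n + 4))) - 2 • e (c 1)) =
      3 • ((∑ q : stab 2 (n + 3) ⧸ (stab 2 (n + 3 + 1)).subgroupOf (stab 2 (n + 3)),
          ((q.out : stab 2 (n + 3)) : Field.absoluteGaloisGroup ℚ_[2]) • e (c (n + 4))) +
        ∑ q : stab 2 (n + 3) ⧸ (stab 2 (n + 3 + 1)).subgroupOf (stab 2 (n + 3)),
          ((q.out : stab 2 (n + 3)) : Field.absoluteGaloisGroup ℚ_[2]) • (σ (n + 4) • e (c (n + 4)))) -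
      2 • (2 • e (c 1)) := by
    simp_rw [smul_sub, smul_comm _ (3 : ℕ), smul_comm _ (2 : ℕ), smul_add, hq1]
    rw [Finset.sum_sub_distrib, Finset.sum_const, Finset.card_univ, card_stab_quot_two (by omega),
      Finset.sum_add_distrib, ← Finset.smul_sum, ← Finset.smul_sum]
  rw [hsum]
  have hS : (∑ q : stab 2 (n + 3) ⧸ (stab 2 (n + 3 + 1)).subgroupOf (stab 2 (n + 3)),
        ((q.out : stab 2 (n + 3)) : Field.absoluteGaloisGroup ℚ_[2]) • e (c (n + 4))) +
      ∑ q : stab 2 (n + 3) ⧸ (stab 2 (n + 3 + 1)).subgroupOf (stab 2 (n + 3)),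
        ((q.out : stab 2 (n + 3)) : Field.absoluteGaloisGroup ℚ_[2]) • (σ (n + 4) • e (c (n + 4))) =
      2 • e (c 1) - (e (c (n + 2)) + σ (n + 2) • e (c (n + 2))) := by
    rw [← hσ42, ← hrel']; abel
  rw [hS]
  abel

/-- **(GEN₀), valuation form: `d_0 ∉ 2·E(ℚ₂)`** — `Λ(d_0) = 3·(ℓ_2 + σℓ_2) + 4 = −2` has `‖·‖ = ‖2‖`, whereas for a
`Γ`-fixed `b` (a point of `E(ℚ₂)`), `3b ∈ Ê(2ℤ₂)` (`#Ẽ(𝔽₂) = 3` as `a₂ = 0`) and `Λ(2·3b) = 2Λ(3b)` has `‖·‖ ≤ ‖4‖`.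
[cite: KuriharaOtsuki2006, §1.3] [cite: SilvermanAEC2009, VII.2 Prop. 2.1, IV.6.4] -/
theorem plusPoints_zero_ne_two_nsmul
    (htr : Literature.NumberTheory.EllipticCurves.HasseManin.tr (M.map PadicInt.toZMod) = 0)
    {c : ℕ → (genFibΩ 2 M).toAffine.Point}
    (hc : haveI := isIntegral_genFib_baseChange 2 M
      ∀ m, c m ∈ subfieldPoints (genFibΩ 2 M) (layer 2 m).toSubfield coeffs_mem_layer ∧
      c m ∈ kernel (Valued.v (R := PadicAlgCl 2)) (genFibΩ 2 M) ∧ ptLogΩ 2 M (c m) = ell 2 m)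
    {σ : ℕ → Field.absoluteGaloisGroup ℚ_[2]} (hσ2 : σ 2 • zeta 2 2 = (zeta 2 2)⁻¹)
    {b : localPoints W ℚ_[2]} (hb : ∀ τ : Field.absoluteGaloisGroup ℚ_[2], τ • b = b) :
    3 • (toLoc hV (c 2) + σ 2 • toLoc hV (c 2)) - 2 • toLoc hV (c 1) ≠ 2 • b := by
  haveI hintΩ := isIntegral_genFib_baseChange 2 M
  intro heq
  set e := toLoc hV with he
  obtain ⟨hDL, hDk, hDℓ⟩ := plusPoints_symm_mem hV hc σ 0
  rw [ell_two_two_add_smul hσ2] at hDℓ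
  have hB : e.symm b ∈ subfieldPoints (genFibΩ 2 M) (layer 2 0).toSubfield coeffs_mem_layer :=
    (forall_smul_eq_iff_mem_subfieldPoints hV 0 b).mp fun τ _ => hb τ
  have hN : Nat.card (M.map PadicInt.toZMod).toAffine.Point = 3 := by rw [natCard_point_eq_of_tr_eq_zero (M := M) htr]
  have h3Bk : 3 • e.symm b ∈ kernel (Valued.v (R := PadicAlgCl 2)) (genFibΩ 2 M) := by
    rw [← hN]
    exact card_smul_mem_kernel_of_mem_subfieldPoints M hB
  have h3BL : 3 • e.symm b ∈ subfieldPoints (genFibΩ 2 M) (layer 2 0).toSubfield coeffs_mem_layer :=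
    (subfieldPoints _ _ _).nsmul_mem hB 3
  have hrel : 3 • e.symm (3 • (e (c 2) + σ 2 • e (c 2)) - 2 • e (c 1)) = 2 • (3 • e.symm b) := by
    rw [heq, map_nsmul, smul_smul, smul_smul, mul_comm]
  have hlog := congrArg (ptLogΩ 2 M) hrel
  rw [ptLogΩ_nsmul (m := 0 + 2) hDL hDk 3, hDℓ, ptLogΩ_nsmul (m := 0) h3BL h3Bk 2] at hlog
  -- `Λ(3b) = −3`, of norm `1`
  have hΛ : ptLogΩ 2 M (3 • e.symm b) = -3 := by
    have h2 : (2 : PadicAlgCl 2) ≠ 0 := two_ne_zero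
    apply mul_left_cancel₀ h2
    push_cast at hlog
    linear_combination -hlog
  have hnorm : ‖ptLogΩ 2 M (3 • e.symm b)‖ = 1 := by
    rw [hΛ, norm_neg, show (3 : PadicAlgCl 2) = algebraMap ℚ_[2] (PadicAlgCl 2) ((3 : ℤ) : ℚ_[2]) by push_cast; rfl,
      norm_algebraMap']
    refine le_antisymm (Padic.norm_int_le_one 3) (not_lt.mp fun h => ?_)
    rw [Padic.norm_intCast_lt_one_iff] at h
    omega
  have hle := norm_ptLogΩ_le_half_of_mem_layer_zero (M := M) h3BL h3Bk
  linarith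

/-- **THE `ℤ₂`-TOWER POINTS AT `2` (packaged).** Let `W/K` (`K ⊆ ℚ₂`) have a `ℤ₂`-model `M` with elliptic fibres,
`2 ∣ a₁(M)`, `tr(M ⊗ 𝔽₂) = 0` (good supersingular, `a₂ = 0`) and `M ⊗ ℚ̄₂ = W ⊗ ℚ̄₂`. Then there are Kobayashi tower points
`c_m ∈ E(ℚ₂(ζ_{2^m})) ∩ Ê` with `Λ(c_m) = ℓ_m` (files 2/6), inverters `σ_m` of `ζ_{2^m}`, and the family
**`d_n = 3 • (c_{n+2} + σ_{n+2} • c_{n+2}) − 2 • c_1`** in `localPoints W ℚ_[2]` with: (L) `d_n` fixed by `Stab ζ_{2^{n+2}}` and by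
every inverter of `ζ_{2^{n+2}}` (i.e. `d_n ∈ E(ℚ_{2,n})`, `ℚ_{2,n} = ℚ₂(ζ_{2^{n+2}})⁺`); (TR) `∑_{Stab ζ_{2^{n+3}}/Stab ζ_{2^{n+4}}} q̃ • d_{n+2}
= −d_n` EXACTLY; (GEN₀, valuation form) `d_0 ≠ 2 • b` for every `Γ`-fixed `b` (`d_0 ∉ 2E(ℚ₂)`). Kobayashi's Lemma 8.9 /
Sprung's Thm. 2.2 (2′) READ AT `2` on the `ℤ₂`-tower — the point half of the plus Honda system HONDA⁺@2.
[cite: Kobayashi2003, Lemma 8.9, Prop. 8.12 (pp. 16–18)] [cite: Sprung2012, Thm. 2.2 (2′) (p. 1487)] [cite: KuriharaOtsuki2006, §1.3, Prop. 1.4, p. 557] -/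
theorem exists_plusPoints_two (h₁ : M.a₁ ∈ IsLocalRing.maximalIdeal ℤ_[2])
    (htr : Literature.NumberTheory.EllipticCurves.HasseManin.tr (M.map PadicInt.toZMod) = 0)
    (hWM : M.baseChange (AlgebraicClosure ℚ_[2]) = W.baseChange (AlgebraicClosure ℚ_[2]))
    [hFt : ∀ m, Fintype (stab 2 m ⧸ (stab 2 (m + 1)).subgroupOf (stab 2 m))] :
    ∃ (c : ℕ → localPoints W ℚ_[2]) (σ : ℕ → Field.absoluteGaloisGroup ℚ_[2]) (d : ℕ → localPoints W ℚ_[2]),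
      (haveI := isIntegral_genFib_baseChange 2 M
        ∀ m, (toLoc ((genFibΩ_eq_baseChange M).trans hWM)).symm (c m) ∈
            subfieldPoints (genFibΩ 2 M) (layer 2 m).toSubfield coeffs_mem_layer ∧
          (toLoc ((genFibΩ_eq_baseChange M).trans hWM)).symm (c m) ∈ kernel (Valued.v (R := PadicAlgCl 2)) (genFibΩ 2 M) ∧
          ptLogΩ 2 M ((toLoc ((genFibΩ_eq_baseChange M).trans hWM)).symm (c m)) = ell 2 m) ∧
      (∀ m, ∀ τ ∈ stab 2 m, τ • c m = c m) ∧
      (∀ m, 1 ≤ m → σ m • zeta 2 m = (zeta 2 m)⁻¹) ∧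
      (∀ n, d n = 3 • (c (n + 2) + σ (n + 2) • c (n + 2)) - 2 • c 1) ∧
      (∀ n, ∀ τ ∈ stab 2 (n + 2), τ • d n = d n) ∧
      (∀ n (σ' : Field.absoluteGaloisGroup ℚ_[2]), σ' • zeta 2 (n + 2) = (zeta 2 (n + 2))⁻¹ → σ' • d n = d n) ∧
      (∀ n, ∑ q : stab 2 (n + 3) ⧸ (stab 2 (n + 3 + 1)).subgroupOf (stab 2 (n + 3)),
          ((q.out : stab 2 (n + 3)) : Field.absoluteGaloisGroup ℚ_[2]) • d (n + 2) = -d n) ∧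
      (∀ b : localPoints W ℚ_[2], (∀ τ : Field.absoluteGaloisGroup ℚ_[2], τ • b = b) → d 0 ≠ 2 • b) := by
  have hV : genFibΩ 2 M = W.baseChange (AlgebraicClosure ℚ_[2]) := (genFibΩ_eq_baseChange M).trans hWM
  haveI hintΩ : (genFibΩ 2 M).IsIntegral (Valued.v (R := PadicAlgCl 2)).integer := isIntegral_genFib_baseChange 2 M
  obtain ⟨cΩ, -, hcΩ⟩ := exists_towerPoints 2 M htr
  have hσex : ∀ m : ℕ, ∃ σ : Field.absoluteGaloisGroup ℚ_[2], σ • zeta 2 (m + 1) = (zeta 2 (m + 1))⁻¹ :=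
    fun m => exists_smul_zeta_eq_inv 2 (by omega)
  choose σ₀ hσ₀ using hσex
  set σ : ℕ → Field.absoluteGaloisGroup ℚ_[2] := fun m => σ₀ (m - 1) with hσ_def
  have hσ : ∀ m, 1 ≤ m → σ m • zeta 2 m = (zeta 2 m)⁻¹ := fun m hm => by
    obtain ⟨k, rfl⟩ := Nat.exists_eq_add_of_le' hm
    simp only [hσ_def, Nat.add_sub_cancel]
    exact hσ₀ k
  refine ⟨fun m => toLoc hV (cΩ m), σ, fun n => 3 • (toLoc hV (cΩ (n + 2)) + σ (n + 2) • toLoc hV (cΩ (n + 2))) -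
    2 • toLoc hV (cΩ 1), fun m => ?_, fun m τ hτ => smul_toLoc_eq_of_mem_stab hV hcΩ m hτ, hσ, fun n => rfl,
    fun n τ hτ => plusPoints_smul_eq_of_mem_stab hV hcΩ σ n hτ,
    fun n σ' hσ' => plusPoints_smul_eq_of_inverter hV hcΩ n (hσ (n + 2) (by omega)) hσ',
    fun n => plusPoints_trace hV h₁ hcΩ hσ n, fun b hb => plusPoints_zero_ne_two_nsmul hV htr hcΩ (hσ 2 (by omega)) hb⟩
  simp only [AddEquiv.symm_apply_apply]
  exact hcΩ m

end Loc

/-! ## §6 For `W/ℚ` itself: globally minimal, `GoodSS W 2`, `a₂(W) = 0` (the model `M_W` of file 6) -/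

section Curve

/-- **The `ℤ₂`-tower points at `2` for `W/ℚ` globally minimal with `GoodSS W 2` and `a₂(W) = 0`**, on the good supersingular
`ℤ₂`-model `M_W = integralModelInt W ⊗ ℤ₂` of file 6 (`2 ∣ a₁`, `tr = a₂(W) = 0`, `M_W ⊗ ℚ̄₂ = W ⊗ ℚ̄₂`): the conclusion of
`exists_plusPoints_two` with NO hypothesis beyond K3's/K4's binders — tower points `c_m`, inverters `σ_m`, and
`d_n = 3 • (c_{n+2} + σ_{n+2} • c_{n+2}) − 2 • c_1 ∈ E(ℚ_{2,n})` with `Tr_{n+2/n+1} d_{n+2} = −d_n` and `d_0 ∉ 2E(ℚ₂)`.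
[cite: Kobayashi2003, Lemma 8.9, Prop. 8.12 (pp. 16–18)] [cite: Sprung2012, Thm. 2.2 (2′) (p. 1487)] [cite: KuriharaOtsuki2006, p. 557] -/
theorem exists_plusPoints_two_of_goodSS (W : WeierstrassCurve ℚ) [W.IsElliptic] [W.IsGloballyMinimal]
    (hss : GoodSS W 2) (ha : W.frobeniusTrace 2 = 0)
    [hFt : ∀ m, Fintype (stab 2 m ⧸ (stab 2 (m + 1)).subgroupOf (stab 2 m))] :
    ∃ (c : ℕ → localPoints W ℚ_[2]) (σ : ℕ → Field.absoluteGaloisGroup ℚ_[2]) (d : ℕ → localPoints W ℚ_[2]),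
      (haveI := isIntegral_genFib_baseChange 2 ((integralModelInt W).map (Int.castRingHom ℤ_[2]))
        ∀ m, (toLoc ((genFibΩ_eq_baseChange ((integralModelInt W).map (Int.castRingHom ℤ_[2]))).trans
              (baseChange_twoAdicModel W))).symm (c m) ∈
            subfieldPoints (genFibΩ 2 ((integralModelInt W).map (Int.castRingHom ℤ_[2]))) (layer 2 m).toSubfield
              coeffs_mem_layer ∧
          (toLoc ((genFibΩ_eq_baseChange ((integralModelInt W).map (Int.castRingHom ℤ_[2]))).trans
              (baseChange_twoAdicModel W))).symm (c m) ∈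
            kernel (Valued.v (R := PadicAlgCl 2)) (genFibΩ 2 ((integralModelInt W).map (Int.castRingHom ℤ_[2]))) ∧
          ptLogΩ 2 ((integralModelInt W).map (Int.castRingHom ℤ_[2]))
            ((toLoc ((genFibΩ_eq_baseChange ((integralModelInt W).map (Int.castRingHom ℤ_[2]))).trans
              (baseChange_twoAdicModel W))).symm (c m)) = ell 2 m) ∧
      (∀ m, ∀ τ ∈ stab 2 m, τ • c m = c m) ∧
      (∀ m, 1 ≤ m → σ m • zeta 2 m = (zeta 2 m)⁻¹) ∧
      (∀ n, d n = 3 • (c (n + 2) + σ (n + 2) • c (n + 2)) - 2 • c 1) ∧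
      (∀ n, ∀ τ ∈ stab 2 (n + 2), τ • d n = d n) ∧
      (∀ n (σ' : Field.absoluteGaloisGroup ℚ_[2]), σ' • zeta 2 (n + 2) = (zeta 2 (n + 2))⁻¹ → σ' • d n = d n) ∧
      (∀ n, ∑ q : stab 2 (n + 3) ⧸ (stab 2 (n + 3 + 1)).subgroupOf (stab 2 (n + 3)),
          ((q.out : stab 2 (n + 3)) : Field.absoluteGaloisGroup ℚ_[2]) • d (n + 2) = -d n) ∧
      (∀ b : localPoints W ℚ_[2], (∀ τ : Field.absoluteGaloisGroup ℚ_[2], τ • b = b) → d 0 ≠ 2 • b) := by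
  haveI := isElliptic_coe_twoAdicModel W
  haveI := isElliptic_toZMod_twoAdicModel W hss.1
  have htr : Literature.NumberTheory.EllipticCurves.HasseManin.tr
      (((integralModelInt W).map (Int.castRingHom ℤ_[2])).map PadicInt.toZMod) = 0 := by
    rw [tr_twoAdicModel W hss.1, ha]
  exact exists_plusPoints_two (a₁_twoAdicModel_mem W hss) htr (baseChange_twoAdicModel W)

end Curve




end SignedKatoOffTwo.LocalTwo

end Summit.BirchSwinnertonDyer.BirchSwinnertonDyer.Theorems

end
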